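import Mathlib
import Summits.Ventures.PercRepro2.Defs
import Summits.Ventures.PercRepro2.Independence
import Summits.Ventures.PercRepro2.Harris
import Summits.Ventures.PercRepro2.Graph
import Summits.Ventures.PercRepro2.Exploration
import Summits.Ventures.PercRepro2.Events
import Summits.Ventures.PercRepro2.FourFunctions
import Summits.Ventures.PercRepro2.Induced
import Summits.Ventures.PercRepro2.Frontier
import Summits.Ventures.PercRepro2.ObsIndependence
import Summits.Ventures.PercRepro2.BHK
import Summits.Ventures.PercRepro2.BHKEvents
import Summits.Ventures.PercRepro2.SideAgreement
import Summits.Ventures.PercRepro2.VdBKahn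
import Summits.Ventures.PercRepro2.BHKAvoid
import Summits.Ventures.PercRepro2.R2PrimeThreeReduction
import Summits.Ventures.PercRepro2.YBridge
import Summits.Ventures.PercRepro2.Yu1Functionals
import Summits.Ventures.PercRepro2.Yu1Events
import Summits.Ventures.PercRepro2.Yu1
import Summits.Ventures.PercRepro2.LBSplit
import Summits.Ventures.PercRepro2.YDelta
import Summits.Ventures.PercRepro2.SD
import Summits.Ventures.PercRepro2.Threshold
import Summits.Ventures.PercRepro2.Lambda
import Summits.Ventures.PercRepro2.LambdaTau
import Summits.Ventures.PercRepro2.LambdaSlack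
import Summits.Ventures.PercRepro2.HF2
import Summits.Ventures.PercRepro2.Yu2
import Summits.Ventures.PercRepro2.N0
import Summits.Ventures.PercRepro2.Y
import Summits.Ventures.PercRepro2.YDeltaTools
import Summits.Ventures.PercRepro2.ZDelta
import Summits.Ventures.PercRepro2.ZExpand
import Summits.Ventures.PercRepro2.ISplit
import Summits.Ventures.PercRepro2.MRl
import Summits.Ventures.PercRepro2.ZOloc
import Summits.Ventures.PercRepro2.SideBridge
import Summits.Ventures.PercRepro2.HCov
import Summits.Ventures.PercRepro2.BasePrime
import Summits.Ventures.PercRepro2.PendantRoot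

/-!
# (HCOV) at a pendant `a₃` attached to `o` (blind cell PercRepro2, typer-1; mine-a g2
`MINEA-LOCALSUPER.md` §13 FACT C "x = o", INBOX 2026-08-23T09:38:10Z; lead g11 ASSIGNMENTS v11.8 (3))

With `a₃` a leaf attached to `o` by the edge `f` of weight `q`, `a₃ ∈ C(a_i)` iff `f` is open and
`o ∈ C(a_i)`; hence `T = Q ∩ {f open} ∩ {o ∈ C₂}`, `T′ = Q ∩ {f open} ∩ {o ∈ C₁}`,
`PD = Q ∖ ({f open} ∩ {o ∈ U})` (`TEvent_pendant_o`, `TEvent'_pendant_o`, `PDEvent_pendant_o`), and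
every atom of `Gc` is an `a₃`-free mass up to the factor `q` (`prob_T_inter_o`, `prob_T'_inter_o`,
`prob_PD_inter_o`; under `Q` the events `{o ∈ C₁}`, `{o ∈ C₂}` are disjoint).

* **`Gc_pendant_o`** (mine-a's identity `G = (1 − q)/(1 − qα) · G_{a₃-free}`, cleared):
  `Gc = −2 (1 − q) P(Q) [C(oH, bL) + C(oL, bH)]` — a positive multiple of the `a₃`-free functional,
  which is the sum of two cross-cluster covariances;
* **`HCov_pendant_o`**: (HCOV) holds at every admissible weight vector whose `a₃` is a leaf at `o`
  (BHK 1.3 twice, `PendantRoot.covC_cross_nonpos`).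
-/

namespace Summit.Ventures.PercRepro2

open UnionCluster CovForm PendantRoot

namespace PendantO

variable {V : Type*} {E : Type*} [Fintype E] [DecidableEq E] {R : Type*} [Field R]
  [LinearOrder R] [IsStrictOrderedRing R]

section Events

variable {ends : E → Sym2 V} {f : E} {a₃ o : V}

omit [Fintype E] [DecidableEq E] in
/-- Connection events are symmetric. -/
lemma connEvent_comm (ends : E → Sym2 V) (x y : V) : connEvent ends x y = connEvent ends y x := by
  ext ω
  exact ⟨conn_symm, conn_symm⟩

omit [Fintype E] [DecidableEq E] in
/-- `Q = {a₁ ↮ a₂}` is free when both roots differ from the leaf. -/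
lemma free_Q (hf : ends f = s(a₃, o)) (hleaf : ∀ e, a₃ ∈ ends e → e = f) (h3o : a₃ ≠ o)
    {a₁ a₂ : V} (h31 : a₃ ≠ a₁) (h32 : a₃ ≠ a₂) : Free f (avoidAll ends a₂ {a₁}) := by
  rw [avoidAll_eq_compl]
  exact (free_connEvent hf hleaf h3o (Ne.symm h31) (Ne.symm h32)).compl

omit [Fintype E] [DecidableEq E] in
/-- Free events are closed under union. -/
lemma Free.union {A B : Set (Config E)} (hA : Free f A) (hB : Free f B) : Free f (A ∪ B) := by
  have := dependsOn_union hA hB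
  rwa [Set.union_self] at this

omit [Fintype E] [DecidableEq E] in
/-- The sure event is free. -/
lemma free_univ : Free f (Set.univ : Set (Config E)) := fun _ _ _ => rfl

omit [Fintype E] [DecidableEq E] in
/-- `{a₃ ∈ U} = {f open} ∩ ({o ∈ C₁} ∪ {o ∈ C₂})`. -/
lemma inU_pendant_o (hf : ends f = s(a₃, o)) (hleaf : ∀ e, a₃ ∈ ends e → e = f) (h3o : a₃ ≠ o)
    {a₁ a₂ : V} (h31 : a₃ ≠ a₁) (h32 : a₃ ≠ a₂) :
    inU ends a₁ a₂ a₃ = openEdge f ∩ (connEvent ends a₁ o ∪ connEvent ends a₂ o) := by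
  unfold inU
  rw [connEvent_comm ends a₃ a₁, connEvent_comm ends a₃ a₂, connEvent_other_leaf hf hleaf h3o h31,
    connEvent_other_leaf hf hleaf h3o h32, Set.inter_union_distrib_left]

omit [Fintype E] [DecidableEq E] in
/-- `PD = Q ∖ ({f open} ∩ {o ∈ U})`. -/
lemma PDEvent_pendant_o (hf : ends f = s(a₃, o)) (hleaf : ∀ e, a₃ ∈ ends e → e = f) (h3o : a₃ ≠ o)
    {a₁ a₂ : V} (h31 : a₃ ≠ a₁) (h32 : a₃ ≠ a₂) :
    PDEvent ends a₁ a₂ a₃ =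
      avoidAll ends a₂ {a₁} ∩ (openEdge f ∩ (connEvent ends a₁ o ∪ connEvent ends a₂ o))ᶜ := by
  unfold PDEvent Dtilde
  rw [avoidAll_eq_compl, inU_pendant_o hf hleaf h3o h31 h32]

omit [Fintype E] [DecidableEq E] in
/-- `T = Q ∩ {f open} ∩ {o ∈ C₂}`. -/
lemma TEvent_pendant_o (hf : ends f = s(a₃, o)) (hleaf : ∀ e, a₃ ∈ ends e → e = f) (h3o : a₃ ≠ o)
    {a₁ a₂ : V} (h32 : a₃ ≠ a₂) :
    TEvent ends a₁ a₂ a₃ = avoidAll ends a₂ {a₁} ∩ (openEdge f ∩ connEvent ends a₂ o) := by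
  unfold TEvent
  rw [connEvent_other_leaf hf hleaf h3o h32]
  congr 1
  ext ω
  simp only [Set.mem_compl_iff, connEvent, Set.mem_setOf_eq, avoidAll, Finset.mem_singleton,
    forall_eq]

omit [Fintype E] [DecidableEq E] in
/-- `T′ = Q ∩ {f open} ∩ {o ∈ C₁}`. -/
lemma TEvent'_pendant_o (hf : ends f = s(a₃, o)) (hleaf : ∀ e, a₃ ∈ ends e → e = f) (h3o : a₃ ≠ o)
    {a₁ a₂ : V} (h31 : a₃ ≠ a₁) :
    TEvent ends a₂ a₁ a₃ = avoidAll ends a₂ {a₁} ∩ (openEdge f ∩ connEvent ends a₁ o) := by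
  unfold TEvent
  rw [connEvent_other_leaf hf hleaf h3o h31, avoidAll_eq_compl]

omit [Fintype E] [DecidableEq E] in
/-- Under `Q`, `o` lies in at most one root cluster. -/
lemma Q_inter_both_eq_empty (ends : E → Sym2 V) (a₁ a₂ o : V) (Y : Set (Config E)) :
    avoidAll ends a₂ {a₁} ∩ (connEvent ends a₁ o ∩ (connEvent ends a₂ o ∩ Y)) = ∅ := by
  ext ω
  simp only [Set.mem_inter_iff, avoidAll, Set.mem_setOf_eq, Finset.mem_singleton, forall_eq,
    connEvent, Set.mem_empty_iff_false, iff_false, not_and]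
  intro hQ h1 h2 _
  exact hQ (conn_trans h2 (conn_symm h1))

omit [Fintype E] [DecidableEq E] in
/-- Under `Q`, `o` lies in at most one root cluster (other order). -/
lemma Q_inter_both_eq_empty' (ends : E → Sym2 V) (a₁ a₂ o : V) (Y : Set (Config E)) :
    avoidAll ends a₂ {a₁} ∩ (connEvent ends a₂ o ∩ (connEvent ends a₁ o ∩ Y)) = ∅ := by
  rw [Set.inter_left_comm (connEvent ends a₂ o)]
  exact Q_inter_both_eq_empty ends a₁ a₂ o Y

omit [Fintype E] [DecidableEq E] in
/-- Under `Q`, `o` lies in at most one root cluster (two factors). -/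
lemma Q_inter_both_eq_empty₂ (ends : E → Sym2 V) (a₁ a₂ o : V) :
    avoidAll ends a₂ {a₁} ∩ (connEvent ends a₁ o ∩ connEvent ends a₂ o) = ∅ := by
  have := Q_inter_both_eq_empty ends a₁ a₂ o Set.univ
  rwa [Set.inter_univ] at this

omit [Fintype E] [DecidableEq E] in
/-- Under `Q`, `o` lies in at most one root cluster (two factors, other order). -/
lemma Q_inter_both_eq_empty₂' (ends : E → Sym2 V) (a₁ a₂ o : V) :
    avoidAll ends a₂ {a₁} ∩ (connEvent ends a₂ o ∩ connEvent ends a₁ o) = ∅ := by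
  rw [Set.inter_comm (connEvent ends a₂ o)]
  exact Q_inter_both_eq_empty₂ ends a₁ a₂ o

omit [Fintype E] [DecidableEq E] in
/-- `X ∩ (X ∩ Y) = X ∩ Y` inside `Q`. -/
lemma Q_inter_idem (Q X Y : Set (Config E)) : Q ∩ (X ∩ (X ∩ Y)) = Q ∩ (X ∩ Y) := by
  rw [← Set.inter_assoc X X Y, Set.inter_self]

end Events

section Atoms

variable {ends : E → Sym2 V} {f : E} {a₃ o : V} (p : E → R)

omit [LinearOrder R] [IsStrictOrderedRing R] in
/-- `P(T ∩ X) = q · P(Q ∩ ({o ∈ C₂} ∩ X))` for free `X`. -/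
lemma prob_T_inter_o (hf : ends f = s(a₃, o)) (hleaf : ∀ e, a₃ ∈ ends e → e = f) (h3o : a₃ ≠ o)
    {a₁ a₂ : V} (h31 : a₃ ≠ a₁) (h32 : a₃ ≠ a₂) {X : Set (Config E)} (hX : Free f X) :
    prob p (TEvent ends a₁ a₂ a₃ ∩ X) =
      p f * prob p (avoidAll ends a₂ {a₁} ∩ (connEvent ends a₂ o ∩ X)) := by
  rw [TEvent_pendant_o hf hleaf h3o h32]
  have hset : avoidAll ends a₂ {a₁} ∩ (openEdge f ∩ connEvent ends a₂ o) ∩ X =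
      avoidAll ends a₂ {a₁} ∩ (connEvent ends a₂ o ∩ X) ∩ openEdge f := by
    ext ω; simp only [Set.mem_inter_iff]; tauto
  rw [hset, prob_inter_openEdge_of_free p
    ((free_Q hf hleaf h3o h31 h32).inter ((free_connEvent hf hleaf h3o (Ne.symm h32) (Ne.symm h3o)).inter hX)),
    mul_comm]

omit [LinearOrder R] [IsStrictOrderedRing R] in
/-- `P(T′ ∩ X) = q · P(Q ∩ ({o ∈ C₁} ∩ X))` for free `X`. -/
lemma prob_T'_inter_o (hf : ends f = s(a₃, o)) (hleaf : ∀ e, a₃ ∈ ends e → e = f) (h3o : a₃ ≠ o)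
    {a₁ a₂ : V} (h31 : a₃ ≠ a₁) (h32 : a₃ ≠ a₂) {X : Set (Config E)} (hX : Free f X) :
    prob p (TEvent ends a₂ a₁ a₃ ∩ X) =
      p f * prob p (avoidAll ends a₂ {a₁} ∩ (connEvent ends a₁ o ∩ X)) := by
  rw [TEvent'_pendant_o hf hleaf h3o h31]
  have hset : avoidAll ends a₂ {a₁} ∩ (openEdge f ∩ connEvent ends a₁ o) ∩ X =
      avoidAll ends a₂ {a₁} ∩ (connEvent ends a₁ o ∩ X) ∩ openEdge f := by
    ext ω; simp only [Set.mem_inter_iff]; tauto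
  rw [hset, prob_inter_openEdge_of_free p
    ((free_Q hf hleaf h3o h31 h32).inter ((free_connEvent hf hleaf h3o (Ne.symm h31) (Ne.symm h3o)).inter hX)),
    mul_comm]

omit [LinearOrder R] [IsStrictOrderedRing R] in
/-- `P(PD ∩ X) = P(Q ∩ X) − q · P(Q ∩ ({o ∈ C₁} ∩ X)) − q · P(Q ∩ ({o ∈ C₂} ∩ X))` for free `X`. -/
lemma prob_PD_inter_o (hf : ends f = s(a₃, o)) (hleaf : ∀ e, a₃ ∈ ends e → e = f) (h3o : a₃ ≠ o)
    {a₁ a₂ : V} (h31 : a₃ ≠ a₁) (h32 : a₃ ≠ a₂) {X : Set (Config E)} (hX : Free f X) :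
    prob p (PDEvent ends a₁ a₂ a₃ ∩ X) =
      prob p (avoidAll ends a₂ {a₁} ∩ X) -
        p f * prob p (avoidAll ends a₂ {a₁} ∩ (connEvent ends a₁ o ∩ X)) -
        p f * prob p (avoidAll ends a₂ {a₁} ∩ (connEvent ends a₂ o ∩ X)) := by
  set Q := avoidAll ends a₂ {a₁} with hQdef
  set c₁ := connEvent ends a₁ o
  set c₂ := connEvent ends a₂ o
  have hQ : Free f Q := free_Q hf hleaf h3o h31 h32
  have hc₁ : Free f c₁ := free_connEvent hf hleaf h3o (Ne.symm h31) (Ne.symm h3o)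
  have hc₂ : Free f c₂ := free_connEvent hf hleaf h3o (Ne.symm h32) (Ne.symm h3o)
  rw [PDEvent_pendant_o hf hleaf h3o h31 h32]
  -- `PD ∩ X = (Q ∩ X) ∖ B` with `B = {f open} ∩ (c₁ ∪ c₂)`
  have hset : Q ∩ (openEdge f ∩ (c₁ ∪ c₂))ᶜ ∩ X = (Q ∩ X) ∩ (openEdge f ∩ (c₁ ∪ c₂))ᶜ := by
    ext ω; simp only [Set.mem_inter_iff, Set.mem_compl_iff]; tauto
  rw [hset]
  have h1 := prob_inter_add_prob_inter_compl p (Q ∩ X) (openEdge f ∩ (c₁ ∪ c₂))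
  -- the removed part: `(Q ∩ X) ∩ {f open} ∩ (c₁ ∪ c₂) = ((Q ∩ X) ∩ (c₁ ∪ c₂)) ∩ {f open}`
  have hset2 : Q ∩ X ∩ (openEdge f ∩ (c₁ ∪ c₂)) = (Q ∩ X ∩ (c₁ ∪ c₂)) ∩ openEdge f := by
    ext ω; simp only [Set.mem_inter_iff]; tauto
  rw [hset2, prob_inter_openEdge_of_free p ((hQ.inter hX).inter (Free.union hc₁ hc₂))] at h1
  -- the union: `P((Q ∩ X) ∩ (c₁ ∪ c₂)) = P(Q ∩ (c₁ ∩ X)) + P(Q ∩ (c₂ ∩ X))` (the intersection is empty)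
  have h2 := prob_union_add_prob_inter p (Q ∩ X ∩ c₁) (Q ∩ X ∩ c₂)
  have hset3 : Q ∩ X ∩ c₁ ∪ Q ∩ X ∩ c₂ = Q ∩ X ∩ (c₁ ∪ c₂) := by
    ext ω; simp only [Set.mem_inter_iff, Set.mem_union]; tauto
  have hset4 : Q ∩ X ∩ c₁ ∩ (Q ∩ X ∩ c₂) = Q ∩ (c₁ ∩ (c₂ ∩ X)) := by
    ext ω; simp only [Set.mem_inter_iff]; tauto
  have hset5 : Q ∩ X ∩ c₁ = Q ∩ (c₁ ∩ X) := by
    ext ω; simp only [Set.mem_inter_iff]; tauto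
  have hset6 : Q ∩ X ∩ c₂ = Q ∩ (c₂ ∩ X) := by
    ext ω; simp only [Set.mem_inter_iff]; tauto
  rw [hset3, hset4, Q_inter_both_eq_empty, prob_empty, add_zero, hset5, hset6] at h2
  rw [h2] at h1
  linear_combination h1

omit [LinearOrder R] [IsStrictOrderedRing R] in
/-- `P(T) = q · P(Q ∩ {o ∈ C₂})`. -/
lemma prob_T_o (hf : ends f = s(a₃, o)) (hleaf : ∀ e, a₃ ∈ ends e → e = f) (h3o : a₃ ≠ o)
    {a₁ a₂ : V} (h31 : a₃ ≠ a₁) (h32 : a₃ ≠ a₂) :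
    prob p (TEvent ends a₁ a₂ a₃) = p f * prob p (avoidAll ends a₂ {a₁} ∩ connEvent ends a₂ o) := by
  have := prob_T_inter_o p hf hleaf h3o h31 h32 (X := Set.univ) free_univ
  rwa [Set.inter_univ, Set.inter_univ] at this

omit [LinearOrder R] [IsStrictOrderedRing R] in
/-- `P(T′) = q · P(Q ∩ {o ∈ C₁})`. -/
lemma prob_T'_o (hf : ends f = s(a₃, o)) (hleaf : ∀ e, a₃ ∈ ends e → e = f) (h3o : a₃ ≠ o)
    {a₁ a₂ : V} (h31 : a₃ ≠ a₁) (h32 : a₃ ≠ a₂) :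
    prob p (TEvent ends a₂ a₁ a₃) = p f * prob p (avoidAll ends a₂ {a₁} ∩ connEvent ends a₁ o) := by
  have := prob_T'_inter_o p hf hleaf h3o h31 h32 (X := Set.univ) free_univ
  rwa [Set.inter_univ, Set.inter_univ] at this

omit [LinearOrder R] [IsStrictOrderedRing R] in
/-- `P(PD) = P(Q) − q · P(Q ∩ {o ∈ C₁}) − q · P(Q ∩ {o ∈ C₂})`. -/
lemma prob_PD_o (hf : ends f = s(a₃, o)) (hleaf : ∀ e, a₃ ∈ ends e → e = f) (h3o : a₃ ≠ o)
    {a₁ a₂ : V} (h31 : a₃ ≠ a₁) (h32 : a₃ ≠ a₂) :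
    prob p (PDEvent ends a₁ a₂ a₃) =
      prob p (avoidAll ends a₂ {a₁}) - p f * prob p (avoidAll ends a₂ {a₁} ∩ connEvent ends a₁ o) -
        p f * prob p (avoidAll ends a₂ {a₁} ∩ connEvent ends a₂ o) := by
  have := prob_PD_inter_o p hf hleaf h3o h31 h32 (X := Set.univ) free_univ
  rwa [Set.inter_univ, Set.inter_univ, Set.inter_univ, Set.inter_univ] at this

end Atoms

section Main

variable [Fintype V] [DecidableEq V] (p : E → R) (ends : E → Sym2 V)

omit [Fintype V] [DecidableEq V] in
/-- **mine-a's pendant-at-`o` identity** (cleared): with `a₃` a leaf at `o` through `f` (`q = p f`),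
`Gc = −2 (1 − q) P(Q) [C(oH, bL) + C(oL, bH)]`. -/
theorem Gc_pendant_o {f : E} {a₃ o : V} (hf : ends f = s(a₃, o))
    (hleaf : ∀ e, a₃ ∈ ends e → e = f) (h3o : a₃ ≠ o) {a₁ a₂ b : V} (h31 : a₃ ≠ a₁)
    (h32 : a₃ ≠ a₂) (hb : b ≠ a₃) :
    Gc p ends o a₁ a₂ a₃ b =
      -2 * (1 - p f) * prob p (avoidAll ends a₂ {a₁}) *
        (covC p ends a₁ a₂ (connEvent ends a₂ o) (connEvent ends a₁ b) +
          covC p ends a₁ a₂ (connEvent ends a₁ o) (connEvent ends a₂ b)) := by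
  have ho : o ≠ a₃ := Ne.symm h3o
  have c₁o := free_connEvent hf hleaf h3o (Ne.symm h31) ho
  have c₂o := free_connEvent hf hleaf h3o (Ne.symm h32) ho
  have c₁b := free_connEvent hf hleaf h3o (Ne.symm h31) hb
  have c₂b := free_connEvent hf hleaf h3o (Ne.symm h32) hb
  unfold Gc DEF EQbo EQb3 EQb3o EQo EQ3 EQ3o PDb PDbo Do covC
  rw [gap_eq_Q]
  simp only [prob_PD_o p hf hleaf h3o h31 h32, prob_T_o p hf hleaf h3o h31 h32,
    prob_T'_o p hf hleaf h3o h31 h32,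
    prob_PD_inter_o p hf hleaf h3o h31 h32 c₁b, prob_PD_inter_o p hf hleaf h3o h31 h32 c₂b,
    prob_PD_inter_o p hf hleaf h3o h31 h32 c₁o, prob_PD_inter_o p hf hleaf h3o h31 h32 c₂o,
    prob_PD_inter_o p hf hleaf h3o h31 h32 (c₁o.inter c₁b),
    prob_PD_inter_o p hf hleaf h3o h31 h32 (c₂o.inter c₁b),
    prob_PD_inter_o p hf hleaf h3o h31 h32 (c₁o.inter c₂b),
    prob_PD_inter_o p hf hleaf h3o h31 h32 (c₂o.inter c₂b),
    prob_T_inter_o p hf hleaf h3o h31 h32 c₁b, prob_T_inter_o p hf hleaf h3o h31 h32 c₂b,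
    prob_T_inter_o p hf hleaf h3o h31 h32 c₁o, prob_T_inter_o p hf hleaf h3o h31 h32 c₂o,
    prob_T_inter_o p hf hleaf h3o h31 h32 (c₁o.inter c₁b),
    prob_T_inter_o p hf hleaf h3o h31 h32 (c₂o.inter c₁b),
    prob_T_inter_o p hf hleaf h3o h31 h32 (c₁o.inter c₂b),
    prob_T_inter_o p hf hleaf h3o h31 h32 (c₂o.inter c₂b),
    prob_T'_inter_o p hf hleaf h3o h31 h32 c₁b, prob_T'_inter_o p hf hleaf h3o h31 h32 c₂b,
    prob_T'_inter_o p hf hleaf h3o h31 h32 c₁o, prob_T'_inter_o p hf hleaf h3o h31 h32 c₂o,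
    prob_T'_inter_o p hf hleaf h3o h31 h32 (c₁o.inter c₁b),
    prob_T'_inter_o p hf hleaf h3o h31 h32 (c₂o.inter c₁b),
    prob_T'_inter_o p hf hleaf h3o h31 h32 (c₁o.inter c₂b),
    prob_T'_inter_o p hf hleaf h3o h31 h32 (c₂o.inter c₂b),
    Q_inter_idem, Q_inter_both_eq_empty, Q_inter_both_eq_empty', Q_inter_both_eq_empty₂,
    Q_inter_both_eq_empty₂', prob_empty, Set.inter_self]
  ring

/-- **(HCOV) at a pendant `a₃` attached to `o`** (mine-a §13 FACT C, `x = o`): `0 ≤ Gc` for every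
admissible weight vector. -/
theorem HCov_pendant_o (hp : IsProbVec p) {f : E} {a₃ o : V} (hf : ends f = s(a₃, o))
    (hleaf : ∀ e, a₃ ∈ ends e → e = f) (h3o : a₃ ≠ o) {a₁ a₂ b : V} (h31 : a₃ ≠ a₁)
    (h32 : a₃ ≠ a₂) (hb : b ≠ a₃) : HCov p ends o a₁ a₂ a₃ b := by
  unfold HCov
  rw [Gc_pendant_o p ends hf hleaf h3o h31 h32 hb]
  obtain ⟨h1, h2⟩ := covC_cross_nonpos p ends hp o a₁ a₂ b
  have hq1 := sub_nonneg.2 (hp.le_one f)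
  have hQ := prob_nonneg hp (avoidAll ends a₂ {a₁})
  have : 0 ≤ (1 - p f) * prob p (avoidAll ends a₂ {a₁}) * (-(covC p ends a₁ a₂ (connEvent ends a₂ o)
      (connEvent ends a₁ b) + covC p ends a₁ a₂ (connEvent ends a₁ o) (connEvent ends a₂ b))) :=
    mul_nonneg (mul_nonneg hq1 hQ) (by linarith)
  linarith

end Main

end PendantO

end Summit.Ventures.PercRepro2
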